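import Literature.NumberTheory.Automorphic.CMPrincipalSeriesTraceTorusForm          -- ★ p842217 (B-p18 (g32)) S1: van Dijk in torus form, every N
import Literature.NumberTheory.Automorphic.KTNCalibrationConstant                     -- ★ p842404 (B-p18 (g32)) (A): the KTN calibration constant
import Literature.NumberTheory.Automorphic.CMTorusRegularAEPairwise                   -- ★ p842702 (B-p18 (g32)) (L1): regular torus elements have full measure
import Literature.NumberTheory.Automorphic.UnitaryGroupTorusOrbitalIntegralCanonicalTwo  -- (γ₂) S0 FILE 2 rank-one twin: canonical orbital integral on the torus of `U(Φ₂)`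
import Literature.NumberTheory.Automorphic.CMPrincipalSeriesTraceOrbitalForm          -- ★ the `N = 3` original: `calibration_const_eq`, `mul_reassoc_aux` (numerical bookkeeping, reused)
import Literature.NumberTheory.Automorphic.ConstantTermUnitElementUnitary             -- ★ `mem_cmLocalIntegralLevel_of_torus_mul_unipotent`
import Literature.NumberTheory.Automorphic.UnitaryGroupCMLocalIwasawa                 -- ★ `exists_borel_mul_mem_cmLocalIntegralLevel`
import HarnessLib

/-!
# The character of `i_G(χ)` on `U(H)(L⁺_v) ≅ U(Φ₂)(L⁺_v)` (RANK ONE, `N = 2`) as a torus integral of CANONICAL orbital integrals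
# (Rogawski 1990, Lemma 4.9.2 ∕ (4.9.4) p. 56, §12.5 p. 183; van Dijk 1972)

Topic `NumberTheory/Automorphic`; namespace `Literature.NumberTheory.Automorphic.UnitaryGroup`.  THEOREMS ONLY (no definition, no instance, no notation, no
named fact, no `sorry`).  Cell `pub/hodgecm-mathlib`, line «CMCharIdentityTest» (F0P3b `Cruxes/H413/Lines/F0_P3b_CMCharIdentityTestPaydown.lean` ED. 12 ∕ ED. 13
`stub_inducedCharTransferSigned`), desk F0P3b-plan (g12) FORWARD DEAL 2026-09-01T07:31:16Z: the **G-side half of the S4 closer** of the (N-492S) road.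
For the inner form `U(H)(L⁺_v)` identified with `U(Φ₂)(L⁺_v)` by the frame `e = cmDatumLocalCongr L v T ha h` (★ `LocalUnitaryGroupCongr`), a continuous
character `χ` of the diagonal torus `T`, ANY Haar measure `ν_G` on `U(H)(L⁺_v)` with the CANONICAL orbital measures `m_G` (★ `OrbitalMeasureFamily.IsCanonical`)
and ANY Haar measure `μ_T` on `T`:
* **`smoothTrace_cmPrincipalSeries_map_symm_eq_inv_mul_integral`** —
  `tr i_G(χ)(f ∘ e; e⁻¹_* ν_G) = μ_T(T ∩ K_v)⁻¹ · ∫_T Φ dμ_T` for every `Φ` with, for `μ_T`-a.e. `t = d(d₀, d₁, d₂)`,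
  `Φ(t) = χ(t) δ_B^{1∕2}(t) · J₂(t)⁻¹ · O^{can}_{e t}(f)`, `J₂(t) = χ_R(d₀⁻¹d₁)⁻¹ χ⁻(d₀⁻¹d₂)⁻¹` the torus module of ★
  `classOrbitalIntegral_eq_smul_integral_prod_of_torus_regular` (S0 FILE 2) — Rogawski's (4.9.4) `tr i_G(χ)(f) = ∫_T χ(t) D(t)… Φ(t, f) dt` with the
  Weyl-integration constant made explicit and EQUAL TO `μ_T(T ∩ K_v)⁻¹` (so `= 1` for the `K_v`-normalised torus measure).
Proof: S1 ★ `exists_smoothTrace_cmPrincipalSeries_eq_integral_torus` (`tr = C ∫_T χ δ ∫_{K×N} (f∘e)(k t n k⁻¹)`), the calibration constant ★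
`measureReal_eq_mul_of_integral_eq_mul_integral_KTN` (`ν(K) = C μ_K(K) μ_T(T∩K) μ_N(N∩K)`), S0 FILE 2 at the `μ_T`-a.e. regular `t` (★
`ae_isUnit_torusEntry_sub_three`): `∫_{K×N} (f∘e)(k t n k⁻¹) = [ν(K)∕(μ_K(K) μ_N(N∩K)) · J₂(t)]⁻¹ O^{can}_{e t}(f)`, and `MeasureTheory.integral_congr_ae`.
Every finite place `v` inert or ramified in `L ∕ L⁺` (binder `hw`, needed by FILE 2 for `∏_{w ∣ v} L_w` to be a field).
HONEST LABEL: HC_CM is proved only modulo the printed citations (2 remaining named inputs hLiu418, h413) until rung 0 closes; this file pays no letter by itself.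

## References
* [Rogawski1990] J. D. Rogawski, *Automorphic Representations of Unitary Groups in Three Variables* (1990), §4.9 Lemma 4.9.2, (4.9.4) p. 56; §12.5 p. 183.
* [vanDijk1972] G. van Dijk, *Computation of certain induced characters of p-adic groups*, Math. Ann. 199 (1972), Thm. p. 237.
* [HarishChandra1970] Harish-Chandra, *Harmonic analysis on reductive p-adic groups*, LNM 162 (1970), §§3–5.
-/

set_option autoImplicit false

noncomputable section

open NumberField IsDedekindDomain MeasureTheory MeasureTheory.Measure Topology Filter
open scoped Matrix MatrixGroups NNReal ENNReal

namespace Literature.NumberTheory.Automorphic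

namespace UnitaryGroup

open Literature.NumberTheory.Rogawski1990 (IsRegularElt)
open Literature.MeasureTheory.Group

/-! ## §2 The G-side trace formula with canonical orbital integrals -/

section CM

variable (L : Type) [Field L] [NumberField L] [IsCMField L]

set_option maxHeartbeats 3200000 in
set_option synthInstance.maxHeartbeats 400000 in
/-- **Rogawski (4.9.4) on the inner form, canonical orbital integrals, explicit constant.**  For `H` hermitian with `det H` a unit, a place `v` of `L⁺`
that does not split in `L` (`hw`), a frame `e = cmDatumLocalCongr L v T ha h : U(Φ₂)(L⁺_v) ≃ U(H)(L⁺_v)`, a Haar measure `ν_G` on `U(H)(L⁺_v)` whose canonical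
orbital measures are `m_G`, a character `χ` of the diagonal torus `T` with `t ↦ χ(t)` continuous, a Haar measure `μ_T` on `T` and a locally constant
compactly supported `f` on `U(H)(L⁺_v)`:
`(cmPrincipalSeries L 2 v χ).smoothTrace (e⁻¹_* ν_G) (f ∘ e) = μ_T{t | t ∈ K_v}⁻¹ · ∫_T Φ dμ_T`
for every `Φ : T → ℂ` which `μ_T`-a.e. equals `χ(t) δ_B^{1∕2}(t) · J₂(t)⁻¹ · classOrbitalIntegral m_G f ⟦e t⟧` (`J₂(t) = χ_R(d₀⁻¹d₁)⁻¹ · χ⁻(d₀⁻¹d₂)⁻¹`,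
stated for every diagonal writing `t = diag(d)` with `d₀⁻¹d₁ − 1`, `d₀⁻¹d₂ − 1` units — these hold `μ_T`-a.e. by ★ `ae_isUnit_torusEntry_sub_three`).
[cite: Rogawski1990, §4.9 Lemma 4.9.2, (4.9.4) p. 56; §12.5 p. 183] [cite: vanDijk1972, Thm. p. 237] -/
theorem smoothTrace_cmPrincipalSeries_two_map_symm_eq_inv_mul_integral
    (H : Matrix (Fin 2) (Fin 2) L) (hH : (H.map (IsCMField.complexConj L))ᵀ = H) (hHd : IsUnit H.det)
    {v : HeightOneSpectrum (𝓞 ↥(maximalRealSubfield L))} (w : PlacesOver L v) (hw : IsCMField.complexConj L • w.1 = w.1)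
    (T : GL (Fin 2) (LocalRing L v)) {a : LocalRing L v} (ha : IsUnit a)
    (h : formCongr (conjLocal L (IsCMField.complexConj L) v) T (H.map (algebraMap L (LocalRing L v))) =
      a • (Matrix.of fun i j : Fin 2 => if i.val + j.val + 1 = 2 then (1 : L) else 0).map (algebraMap L (LocalRing L v)))
    [MeasurableSpace ((cmDatum L 2 H).Local v)] [BorelSpace ((cmDatum L 2 H).Local v)]
    [∀ γ : (cmDatum L 2 H).Local v, MeasurableSpace (((cmDatum L 2 H).Local v) ⧸ Subgroup.centralizer ({γ} : Set ((cmDatum L 2 H).Local v)))]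
    [∀ γ : (cmDatum L 2 H).Local v, BorelSpace (((cmDatum L 2 H).Local v) ⧸ Subgroup.centralizer ({γ} : Set ((cmDatum L 2 H).Local v)))]
    (νG : Measure ((cmDatum L 2 H).Local v)) [νG.IsHaarMeasure] [νG.IsMulRightInvariant]
    {mG : OrbitalMeasureFamily ((cmDatum L 2 H).Local v)}
    (hmG : mG.IsCanonical (fun γ => IsRegularElt (γ.val : GL (Fin 2) (LocalRing L v))) νG)
    [MeasurableSpace ↥(unitaryGroupOfForm (conjLocal L (IsCMField.complexConj L) v) (cmLocalForm L 2 v))]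
    [BorelSpace ↥(unitaryGroupOfForm (conjLocal L (IsCMField.complexConj L) v) (cmLocalForm L 2 v))]
    (χ : ↥(torusU (conjLocal L (IsCMField.complexConj L) v) (cmLocalForm L 2 v)) →* ℂˣ) (hχ : Continuous fun t => ((χ t : ℂˣ) : ℂ))
    (μT : Measure ↥(cmBorelTriple L 2 v).M) [μT.IsHaarMeasure]
    (f : (cmDatum L 2 H).Local v → ℂ) (hf : IsLocallyConstant f) (hfc : HasCompactSupport f)
    (Φ : ↥(cmBorelTriple L 2 v).M → ℂ)
    (hΦ : haveI := locallyCompactSpace_cmBorelU L 2 v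
      ∀ᵐ (t : ↥(cmBorelTriple L 2 v).M) ∂μT, ∀ (d : Fin 2 → (LocalRing L v)ˣ)
      (hd : glDiagonal 2 (LocalRing L v) d =
        ((t : ↥(unitaryGroupOfForm (conjLocal L (IsCMField.complexConj L) v) (cmLocalForm L 2 v))) : GL (Fin 2) (LocalRing L v)))
      (hb : IsUnit ((((d 0)⁻¹ * d 1 : (LocalRing L v)ˣ) : LocalRing L v) - 1)),
      Φ t = ((χ t : ℂˣ) : ℂ) *
          ((rootDeltaChar (cmBorelTriple L 2 v).P
            ⟨(t : ↥(unitaryGroupOfForm (conjLocal L (IsCMField.complexConj L) v) (cmLocalForm L 2 v))), (cmBorelTriple L 2 v).M_le t.2⟩ : ℂˣ) : ℂ) *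
        (((letI : MeasurableSpace (LocalRing L v) := borel _; haveI : BorelSpace (LocalRing L v) := ⟨rfl⟩
          haveI : SecondCountableTopology (LocalRing L v) := secondCountableTopology_localRing (E := L) v
          ((HeisRing.skewModulus (conjLocal L (IsCMField.complexConj L) v) (continuous_conjLocal L (IsCMField.complexConj L) v) hb.unit
              (LineRing.map_unit_torusScalar_sub_one_two (conjLocal L (IsCMField.complexConj L) v) (cmLocalForm_eq_over L 2 v) t hd hb))⁻¹ :
                ℝ≥0)) : ℝ) : ℂ)⁻¹ *
        classOrbitalIntegral mG f
          (ConjClasses.mk (cmDatumLocalCongr L v T ha h (t : ↥(unitaryGroupOfForm (conjLocal L (IsCMField.complexConj L) v) (cmLocalForm L 2 v)))))) :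
    (cmPrincipalSeries L 2 v χ).smoothTrace (νG.map (cmDatumLocalCongr L v T ha h).symm)
        (fun x : ↥(unitaryGroupOfForm (conjLocal L (IsCMField.complexConj L) v) (cmLocalForm L 2 v)) => f (cmDatumLocalCongr L v T ha h x)) =
      (((μT.real {t : ↥(cmBorelTriple L 2 v).M |
          (t : ↥(unitaryGroupOfForm (conjLocal L (IsCMField.complexConj L) v) (cmLocalForm L 2 v))) ∈
            cmLocalIntegralLevel L 2 (Matrix.of fun i j : Fin 2 => if i.val + j.val + 1 = 2 then (1 : L) else 0) v})⁻¹ : ℝ) : ℂ) *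
        ∫ t, Φ t ∂μT := by
  -- instances on `G₃ = U(Φ₂)(L⁺_v)` and its subgroups
  haveI := locallyCompactSpace_cmBorelU L 2 v
  haveI : LocallyCompactSpace ↥(unitaryGroupOfForm (conjLocal L (IsCMField.complexConj L) v) (cmLocalForm L 2 v)) :=
    locallyCompactSpace_local (IsCMField.complexConj L) 2 _ v
  haveI : SecondCountableTopology ↥(unitaryGroupOfForm (conjLocal L (IsCMField.complexConj L) v) (cmLocalForm L 2 v)) :=
    secondCountableTopology_local (IsCMField.complexConj L) 2 _ v
  haveI : T2Space ↥(unitaryGroupOfForm (conjLocal L (IsCMField.complexConj L) v) (cmLocalForm L 2 v)) :=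
    t2Space_cmDatum_local 2 L (Matrix.of fun i j : Fin 2 => if i.val + j.val + 1 = 2 then (1 : L) else 0) v
  haveI : T1Space (LocalRing L v) := inferInstance
  -- the level `K = K_v` as a subgroup of `G₃`, compact open, Iwasawa `G = B · K`, good position `t n ∈ K → t ∈ K`
  set K : Subgroup ↥(unitaryGroupOfForm (conjLocal L (IsCMField.complexConj L) v) (cmLocalForm L 2 v)) :=
    cmLocalIntegralLevel L 2 (Matrix.of fun i j : Fin 2 => if i.val + j.val + 1 = 2 then (1 : L) else 0) v with hK
  have hKv : ∀ g : ↥(unitaryGroupOfForm (conjLocal L (IsCMField.complexConj L) v) (cmLocalForm L 2 v)),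
      g ∈ K ↔ g ∈ cmLocalIntegralLevel L 2 (Matrix.of fun i j : Fin 2 => if i.val + j.val + 1 = 2 then (1 : L) else 0) v :=
    fun g => Iff.rfl
  have hKco := isCompact_isOpen_cmLocalIntegralLevel L 2 (Matrix.of fun i j : Fin 2 => if i.val + j.val + 1 = 2 then (1 : L) else 0) v
  have hKo : IsOpen (K : Set ↥(unitaryGroupOfForm (conjLocal L (IsCMField.complexConj L) v) (cmLocalForm L 2 v))) := hKco.2
  have hKc : IsCompact (K : Set ↥(unitaryGroupOfForm (conjLocal L (IsCMField.complexConj L) v) (cmLocalForm L 2 v))) := hKco.1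
  have hGK : ∀ g : ↥(unitaryGroupOfForm (conjLocal L (IsCMField.complexConj L) v) (cmLocalForm L 2 v)),
      ∃ b : ↥(cmBorelTriple L 2 v).P, ∃ κ ∈ K, g = b * κ := by
    intro g
    obtain ⟨b, κ, hκ, hg⟩ := exists_borel_mul_mem_cmLocalIntegralLevel L 2 v g
    exact ⟨b, κ, (hKv κ).2 hκ, hg⟩
  have hKP : ∀ t ∈ (cmBorelTriple L 2 v).M, ∀ n ∈ (cmBorelTriple L 2 v).N, t * n ∈ K → t ∈ K := by
    intro t ht n hn htn
    exact (hKv t).2 (mem_cmLocalIntegralLevel_of_torus_mul_unipotent L 2 v ht hn ((hKv _).1 htn))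
  haveI : CompactSpace ↥K := isCompact_iff_compactSpace.1 hKc
  -- Haar measures on `K` and `N`
  have hNcl : IsClosed ((cmBorelTriple L 2 v).N : Set ↥(unitaryGroupOfForm (conjLocal L (IsCMField.complexConj L) v) (cmLocalForm L 2 v))) :=
    (isClosed_upperUnitriangular (n := 2) (R := LocalRing L v)).preimage continuous_subtype_val
  haveI : LocallyCompactSpace ↥(cmBorelTriple L 2 v).N := hNcl.isClosedEmbedding_subtypeVal.locallyCompactSpace
  let κ : Measure ↥K := Measure.haar
  let μN : Measure ↥(cmBorelTriple L 2 v).N := Measure.haar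
  -- the transported Haar measure `ν₂ = e⁻¹_* ν_G`
  letI : MeasurableSpace ((cmDatum L 2 (Matrix.of fun i j : Fin 2 => if i.val + j.val + 1 = 2 then (1 : L) else 0)).Local v) :=
    ‹MeasurableSpace ↥(unitaryGroupOfForm (conjLocal L (IsCMField.complexConj L) v) (cmLocalForm L 2 v))›
  haveI : BorelSpace ((cmDatum L 2 (Matrix.of fun i j : Fin 2 => if i.val + j.val + 1 = 2 then (1 : L) else 0)).Local v) :=
    ‹BorelSpace ↥(unitaryGroupOfForm (conjLocal L (IsCMField.complexConj L) v) (cmLocalForm L 2 v))›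
  haveI hν₂ : @Measure.IsHaarMeasure ↥(unitaryGroupOfForm (conjLocal L (IsCMField.complexConj L) v) (cmLocalForm L 2 v)) _ _ _
      (νG.map (cmDatumLocalCongr L v T ha h).symm : Measure ↥(unitaryGroupOfForm (conjLocal L (IsCMField.complexConj L) v) (cmLocalForm L 2 v))) :=
    (cmDatumLocalCongr L v T ha h).symm.isHaarMeasure_map νG
  -- S1: van Dijk in torus form, with THE calibration constant `C`
  obtain ⟨C, hC, hcal, hprod, -⟩ := exists_smoothTrace_cmPrincipalSeries_eq_integral_torus L 2 v χ hχ K hKo hKc hGK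
    (νG.map (cmDatumLocalCongr L v T ha h).symm) μT μN κ
  rw [hprod (fun x : ↥(unitaryGroupOfForm (conjLocal L (IsCMField.complexConj L) v) (cmLocalForm L 2 v)) => f (cmDatumLocalCongr L v T ha h x))
    (hf.comp_continuous (cmDatumLocalCongr L v T ha h).continuous) (hfc.comp_homeomorph (cmDatumLocalCongr L v T ha h).toHomeomorph)]
  -- (A): `ν₂(K) = C · μ_K(K) · (μ_T(T ∩ K) · μ_N(N ∩ K))`
  have hA := measureReal_eq_mul_of_integral_eq_mul_integral_KTN hKo hKc hKP (νG.map (cmDatumLocalCongr L v T ha h).symm) κ μT μN hcal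
  -- positivity ∕ finiteness of the constants
  have hKuniv : κ Set.univ ≠ 0 := isOpen_univ.measure_ne_zero κ Set.univ_nonempty
  have hKuniv' : κ Set.univ ≠ ∞ := measure_ne_top κ _
  have hNS_open : IsOpen {n : ↥(cmBorelTriple L 2 v).N | (n : ↥(unitaryGroupOfForm (conjLocal L (IsCMField.complexConj L) v) (cmLocalForm L 2 v))) ∈ K} :=
    hKo.preimage continuous_subtype_val
  have hNS_cpt : IsCompact {n : ↥(cmBorelTriple L 2 v).N | (n : ↥(unitaryGroupOfForm (conjLocal L (IsCMField.complexConj L) v) (cmLocalForm L 2 v))) ∈ K} :=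
    hNcl.isClosedEmbedding_subtypeVal.isCompact_preimage hKc
  have hNS0 : μN {n : ↥(cmBorelTriple L 2 v).N | (n : ↥(unitaryGroupOfForm (conjLocal L (IsCMField.complexConj L) v) (cmLocalForm L 2 v))) ∈ K} ≠ 0 :=
    hNS_open.measure_ne_zero μN ⟨1, by rw [Set.mem_setOf_eq, OneMemClass.coe_one]; exact K.one_mem⟩
  have hNStop : μN {n : ↥(cmBorelTriple L 2 v).N | (n : ↥(unitaryGroupOfForm (conjLocal L (IsCMField.complexConj L) v) (cmLocalForm L 2 v))) ∈ K} ≠ ∞ :=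
    hNS_cpt.measure_lt_top.ne
  have hTcl := isClosed_torusU_of_t1Space (conjLocal L (IsCMField.complexConj L) v) (cmLocalForm L 2 v)
  have hTS_open : IsOpen {t : ↥(cmBorelTriple L 2 v).M | (t : ↥(unitaryGroupOfForm (conjLocal L (IsCMField.complexConj L) v) (cmLocalForm L 2 v))) ∈ K} :=
    hKo.preimage continuous_subtype_val
  have hTS_cpt : IsCompact {t : ↥(cmBorelTriple L 2 v).M | (t : ↥(unitaryGroupOfForm (conjLocal L (IsCMField.complexConj L) v) (cmLocalForm L 2 v))) ∈ K} :=
    hTcl.isClosedEmbedding_subtypeVal.isCompact_preimage hKc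
  have hTS0 : μT {t : ↥(cmBorelTriple L 2 v).M | (t : ↥(unitaryGroupOfForm (conjLocal L (IsCMField.complexConj L) v) (cmLocalForm L 2 v))) ∈ K} ≠ 0 :=
    hTS_open.measure_ne_zero μT ⟨1, by rw [Set.mem_setOf_eq, OneMemClass.coe_one]; exact K.one_mem⟩
  have hTStop : μT {t : ↥(cmBorelTriple L 2 v).M | (t : ↥(unitaryGroupOfForm (conjLocal L (IsCMField.complexConj L) v) (cmLocalForm L 2 v))) ∈ K} ≠ ∞ :=
    hTS_cpt.measure_lt_top.ne
  have hmes : Measurable ((cmDatumLocalCongr L v T ha h).symm : (cmDatum L 2 H).Local v → ↥(unitaryGroupOfForm (conjLocal L (IsCMField.complexConj L) v) (cmLocalForm L 2 v))) :=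
    (cmDatumLocalCongr L v T ha h).symm.continuous.measurable
  have hνK : (νG.map (cmDatumLocalCongr L v T ha h).symm : Measure ↥(unitaryGroupOfForm (conjLocal L (IsCMField.complexConj L) v) (cmLocalForm L 2 v))).real (K : Set ↥(unitaryGroupOfForm (conjLocal L (IsCMField.complexConj L) v) (cmLocalForm L 2 v))) =
      (νG ((cmDatumLocalCongr L v T ha h).symm ⁻¹' (K : Set ↥(unitaryGroupOfForm (conjLocal L (IsCMField.complexConj L) v) (cmLocalForm L 2 v))))).toReal := by
    rw [measureReal_def]
    exact congrArg ENNReal.toReal (Measure.map_apply hmes hKo.measurableSet)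
  -- pull the constants in and compare the integrands a.e.
  rw [← integral_const_mul, ← integral_const_mul]
  -- (`Eventually.mono` + `beta_reduce`, not `filter_upwards`: the latter dsimps `(cmBorelTriple L 2 v).M ∕ .N ∕ .P` to `torusU ∕ unipotentU ∕ borelU`
  -- and breaks the syntactic match with S1 ∕ FILE 2 below)
  refine integral_congr_ae ((hΦ.and (ae_isUnit_torusEntry_sub_two L v μT)).mono fun t ht => ?_)
  obtain ⟨hΦt, hregt⟩ := ht
  beta_reduce
  -- (a copy of `t.2`, so that `obtain` does not generalize the occurrences of `t.2` in the goal)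
  have ht2 : ∃ d : Fin 2 → (LocalRing L v)ˣ, glDiagonal 2 (LocalRing L v) d = ((t : ↥(unitaryGroupOfForm (conjLocal L (IsCMField.complexConj L) v) (cmLocalForm L 2 v))) : GL (Fin 2) (LocalRing L v)) := t.2
  obtain ⟨d, hd⟩ := ht2
  have hdi : ∀ i, torusEntry (conjLocal L (IsCMField.complexConj L) v) (cmLocalForm L 2 v) i t = d i :=
    fun i => torusEntry_eq_of_glDiagonal_eq _ _ i t d hd
  simp only [hdi] at hregt
  obtain ⟨h01, h10, hb⟩ := hregt
  have hreg : ∀ i j : Fin 2, i ≠ j → IsUnit (((d i : (LocalRing L v)ˣ) : LocalRing L v) - d j) := by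
    intro i j hij
    fin_cases i <;> fin_cases j
    · exact absurd rfl hij
    · exact h01
    · exact h10
    · exact absurd rfl hij
  rw [hΦt d hd hb]
  -- S0 FILE 2 at the regular `t`
  have hO := classOrbitalIntegral_eq_smul_integral_prod_of_torus_regular_two L H hH hHd w hw T ha h νG hmG hKv κ μN t hd hreg hb
    (φ := f) hf.continuous.measurable
  -- the constants of FILE 2
  set cF : ℝ≥0∞ := νG ((cmDatumLocalCongr L v T ha h).symm ⁻¹' (K : Set ↥(unitaryGroupOfForm (conjLocal L (IsCMField.complexConj L) v) (cmLocalForm L 2 v)))) /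
      (κ Set.univ * μN {n | (n : ↥(unitaryGroupOfForm (conjLocal L (IsCMField.complexConj L) v) (cmLocalForm L 2 v))) ∈ K}) with hcF
  set J : ℝ≥0 := (letI : MeasurableSpace (LocalRing L v) := borel _; haveI : BorelSpace (LocalRing L v) := ⟨rfl⟩
          haveI : SecondCountableTopology (LocalRing L v) := secondCountableTopology_localRing (E := L) v
          ((HeisRing.skewModulus (conjLocal L (IsCMField.complexConj L) v) (continuous_conjLocal L (IsCMField.complexConj L) v) hb.unit
              (LineRing.map_unit_torusScalar_sub_one_two (conjLocal L (IsCMField.complexConj L) v) (cmLocalForm_eq_over L 2 v) t hd hb))⁻¹ : ℝ≥0)) with hJ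
  have hJ0 : J ≠ 0 := by
    letI : MeasurableSpace (LocalRing L v) := borel _
    haveI : BorelSpace (LocalRing L v) := ⟨rfl⟩
    haveI : SecondCountableTopology (LocalRing L v) := secondCountableTopology_localRing (E := L) v
    rw [hJ]
    exact inv_ne_zero (HeisRing.skewModulus_pos _ _ _ _).ne'
  -- FILE 2's orbital integral, keyed on the statement's spelling of `⟦e t⟧`
  have hO' : classOrbitalIntegral mG f (ConjClasses.mk (cmDatumLocalCongr L v T ha h (t : ↥(unitaryGroupOfForm (conjLocal L (IsCMField.complexConj L) v) (cmLocalForm L 2 v))))) = _ := hO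
  -- the scalar identity `C = μ_T(T∩K)⁻¹ · J⁻¹ · (c_F · J).toReal`
  have htoReal : (cF * (J : ℝ≥0∞)).toReal =
      (νG.map (cmDatumLocalCongr L v T ha h).symm : Measure ↥(unitaryGroupOfForm (conjLocal L (IsCMField.complexConj L) v) (cmLocalForm L 2 v))).real (K : Set ↥(unitaryGroupOfForm (conjLocal L (IsCMField.complexConj L) v) (cmLocalForm L 2 v))) / (κ.real Set.univ * μN.real {n | (n : ↥(unitaryGroupOfForm (conjLocal L (IsCMField.complexConj L) v) (cmLocalForm L 2 v))) ∈ K}) * (J : ℝ) := by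
    rw [ENNReal.toReal_mul, hcF, ENNReal.toReal_div, ENNReal.toReal_mul, ENNReal.coe_toReal, hνK]
    rfl
  have hκpos : 0 < κ.real Set.univ := ENNReal.toReal_pos hKuniv hKuniv'
  have hNpos : 0 < μN.real {n | (n : ↥(unitaryGroupOfForm (conjLocal L (IsCMField.complexConj L) v) (cmLocalForm L 2 v))) ∈ K} := ENNReal.toReal_pos hNS0 hNStop
  have hTpos : 0 < μT.real {t : ↥(cmBorelTriple L 2 v).M | (t : ↥(unitaryGroupOfForm (conjLocal L (IsCMField.complexConj L) v) (cmLocalForm L 2 v))) ∈ K} := ENNReal.toReal_pos hTS0 hTStop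
  have hCk : (C : ℂ) = (((μT.real {t : ↥(cmBorelTriple L 2 v).M | (t : ↥(unitaryGroupOfForm (conjLocal L (IsCMField.complexConj L) v) (cmLocalForm L 2 v))) ∈ K})⁻¹ : ℝ) : ℂ) * (((J : ℝ≥0) : ℝ) : ℂ)⁻¹ *
      (((cF * (J : ℝ≥0∞)).toReal : ℝ) : ℂ) := by
    rw [htoReal]
    exact calibration_const_eq hC hκpos hTpos hNpos (NNReal.coe_ne_zero.2 hJ0) hA
  -- substitute and compare: the two spellings of the `K × N`-integral agree definitionally
  rw [hO', Complex.real_smul, hCk]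
  exact mul_reassoc_aux _ _ _ _ _

end CM

end UnitaryGroup

end Literature.NumberTheory.Automorphic
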